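import Mathlib.Analysis.InnerProductSpace.Projection.Submodule
import Mathlib.MeasureTheory.Group.Action
import Mathlib.LinearAlgebra.Pi
import Literature.NumberTheory.Automorphic.AutomorphicSpectrum
import HarnessLib

/-!
# Orthogonal projection onto a discrete summand of a unitary representation and of `L²` of an
# automorphic quotient
(Borel–Jacquet, Corvallis (1979), §4.6; Bump, *Automorphic forms and representations* (1997),
proof of Thm. 3.6.1, pp. 340–342; Dixmier, *C\*-algebras* (1977), §5.4, §13.1.2)

Topic `NumberTheory/Automorphic`; namespace `Literature.NumberTheory.Automorphic` (plus deliberate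
dot-notation extensions of `ContRepresentation.ClosedSubrep` / `ContRepresentation.IsDiscretelyDecomposable`,
as in `HilbertRepSpectrum` and `HeckeEigenvectorProjection`). PROOF FILE: theorems only, no definition,
no named fact, no instance, no `sorry`; imports = Mathlib + `AutomorphicSpectrum` (kept minimal on
purpose: this file is a junction module for the `L²` currency and must stay cheap to build).

The Hilbert-space mechanism behind "a non-zero square-integrable automorphic form has a non-zero
component in SOME irreducible constituent `Π` of `L²`, and the component map `p_Π` is
`G(𝔸)`-equivariant, so it preserves `K`-invariance and `K`-types" (Borel–Jacquet (1979), §4.6;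
Bump (1997), p. 342: "the projection of `L²₀` onto the invariant subspace `V` is
`GL(2, 𝔸)`-equivariant"), packaged for the tree's `L²` currency (`AdelicGroupData.rightRegular μ`,
`DiscreteAutomorphicRep 𝒢 μ` of `AutomorphicSpectrum`). Everything is PROVED.

Generic part (`π : ContRepresentation ℂ G H` on a complex Hilbert space, `W : ClosedSubrep π`,
`p_W = W.toSubmodule.starProjection : H →L[ℂ] H`, resp. `W.toSubmodule.orthogonalProjectionOnto`):
* `ClosedSubrep.starProjection_map_apply` / `commute_starProjection` — for unitary `π`,
  `p_W (π g x) = π g (p_W x)` (`H`-valued form of the tree's `W`-valued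
  `ClosedSubrep.orthogonalProjectionOnto_map_apply` (`HeckeEigenvectorProjection`) and of
  `IsUnitary.starProjection_map_eq` (`UnitaryIsotypicProjection`); three lines from
  `ClosedSubrep.orthogonal`, reproved to keep this junction module's imports minimal);
* `ClosedSubrep.apply_starProjection_of_forall`, `…orthogonalProjectionOnto_mem_fixedVectors_of_forall`
  — `p_W` maps `Kf`-invariant vectors of `H` to `Kf`-invariant vectors (of `H`, resp. of `W`);
* `ClosedSubrep.apply_starProjection_eq_sum`, `…toContRep_orthogonalProjectionOnto_eq_sum` — `p_W`
  preserves every finite `K`-TYPE RELATION `π k (v j) = ∑ i ∈ s, c j i • v i` among a family of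
  vectors (how a vector-valued automorphic form of `K_∞`-type `τ` is seen in `L²`); for `τ`-parts
  combine `commute_starProjection` with `Representation.map_homRangeSum_le_of_commute`
  (`UnitaryIsotypicProjection`, not imported here);
* `IsDiscretelyDecomposable.exists_isTopIrreducible_starProjection_ne_zero` (+ `orthogonalProjectionOnto`
  and family forms) — `π.discretePart = ⊤` and `v ≠ 0` ⇒ some irreducible closed `W` has `p_W v ≠ 0`
  (whole-space form of the tree's `ClosedSubrep.exists_isTopIrreducible_orthogonalProjectionOnto_ne_zero`,
  stated there for a sub-representation `C`; unitarity not needed);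
* `IsDiscretelyDecomposable.exists_isTopIrreducible_intertwiner` — OCCURRENCE form: a non-zero linear
  `L : Y → (ι → H)` intertwining a representation `ρ` of `G'` (acting through `j : G' →* G`) with `π`
  coordinatewise gives, composed with a suitable `p_W`, a non-zero `W`-valued coordinatewise intertwiner.

Automorphic part (`𝒢 : AdelicGroupData K`, invariant `μ`, `R = 𝒢.rightRegular μ`, unitary by
`isUnitary_rightRegular`; `Π : DiscreteAutomorphicRep 𝒢 μ`):
* `AdelicGroupData.rightRegular_apply_coeFn_of_ae_eq` (+ `…_eq_of_ae_eq`) — if `f ∈ L²(μ)` is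
  represented a.e. by `φ` then `R g f` is represented a.e. by `x ↦ φ (g⁻¹ • x)`
  (`rightRegular_apply_coeFn` + Mathlib `measurePreserving_smul`): the junction lemma for
  function-valued realisations of automorphic forms in `L²`;
* `DiscreteAutomorphicRep.starProjection_rightRegular`, `…orthogonalProjectionOnto_rightRegular`,
  `…orthogonalProjectionOnto_mem_fixedVectors`, `…rightRegular_starProjection_of_forall`,
  `…rightRegular_starProjection_eq_sum` — `p_Π` intertwines `R`, preserves levels and `K`-types;
* `exists_discreteAutomorphicRep_starProjection_ne_zero` (+ `orthogonalProjectionOnto`, family and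
  intertwiner forms) — if `R` is discretely decomposable (`L² = L²_disc`: tree
  `AdelicGroupData.isDiscretelyDecomposable_rightRegular_of_locallyCompactSpace` for a compact quotient,
  `UnitaryGroup.isDiscretelyDecomposable_rightRegular_adelicGroupData` for an anisotropic unitary
  group), every non-zero `f ∈ L²` has `p_Π f ≠ 0` for some discrete automorphic `Π`.

NOT here: finiteness of the `Π` with a given `K_f × K_∞`-type (admissibility) and any archimedean
statement ("the projection of a holomorphic form is again a holomorphic form") — inputs of the
consumers. Mathlib used: `Submodule.starProjection` / `orthogonalProjectionOnto` API,
`Submodule.iInf_orthogonal`, `Submodule.topologicalClosure_eq_top_iff`, `measurePreserving_smul`,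
`Measure.QuasiMeasurePreserving.ae_eq_comp`, `LinearMap.compLeft`. Nothing is restated.

## References

* A. Borel, H. Jacquet, *Automorphic forms and automorphic representations*, PSPM 33 (1979), part 1,
  §4.6 [BorelJacquet1979].
* D. Bump, *Automorphic forms and representations* (1997), Thm. 3.6.1 and its proof, pp. 340–342
  [Bump1997].
* J. Dixmier, *C\*-algebras* (1977), §5.4, §13.1.2 [Dixmier1977].
-/

noncomputable section

open scoped InnerProductSpace
open MeasureTheory Topology

/-! ### Generic part: unitary representations on a Hilbert space -/

namespace ContRepresentation

section Hilbert

variable {G H : Type*} [Group G] [NormedAddCommGroup H] [InnerProductSpace ℂ H] [CompleteSpace H]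
  {π : ContRepresentation ℂ G H}

namespace ClosedSubrep

/-- **The orthogonal projection `p_W : H → H` onto a closed invariant subspace of a unitary
representation commutes with the group**: `p_W (π g x) = π g (p_W x)`, because `π g (p_W x) ∈ W` and
`π g x - π g (p_W x) = π g (x - p_W x) ∈ Wᗮ` (`Wᗮ` is invariant, `ClosedSubrep.orthogonal`)
(Bump (1997), proof of Thm. 3.6.1, p. 342; Dixmier (1977), §13.1.2). `H`-valued (`starProjection`)
form of the tree's `orthogonalProjectionOnto_map_apply`; deliberate dot-notation extension of
`ContRepresentation.ClosedSubrep`. [cite: Bump1997, Thm. 3.6.1 (proof, p. 342)] -/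
theorem starProjection_map_apply (hπ : π.IsUnitary) (W : ClosedSubrep π) (g : G) (x : H) :
    W.toSubmodule.starProjection (π g x) = π g (W.toSubmodule.starProjection x) := by
  refine Submodule.eq_starProjection_of_mem_orthogonal
    (W.apply_mem g (W.toSubmodule.starProjection_apply_mem x)) ?_
  rw [← map_sub]
  exact (W.orthogonal hπ).apply_mem g (W.toSubmodule.sub_starProjection_mem_orthogonal x)

/-- `p_W` lies in the commutant of `π(G)` (Dixmier (1977), §13.1.2). [cite: Dixmier1977, §13.1.2] -/
theorem commute_starProjection (hπ : π.IsUnitary) (W : ClosedSubrep π) (g : G) :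
    Commute (π g) W.toSubmodule.starProjection :=
  ContinuousLinearMap.ext fun x => (W.starProjection_map_apply hπ g x).symm

/-- The `H`-valued and the `W`-valued projections vanish together (`p_W x ∈ W`, `p_W x = x ↔ x ∈ W`,
`p_W x = 0 ↔ x ∈ Wᗮ` are Mathlib's `Submodule.starProjection_apply_mem` / `starProjection_eq_self_iff` /
`starProjection_apply_eq_zero_iff` applied to `W.toSubmodule`); private plumbing. [folklore] -/
private theorem starProjection_eq_zero_iff_orthogonalProjectionOnto_eq_zero (W : ClosedSubrep π) {x : H} :
    W.toSubmodule.starProjection x = 0 ↔ W.toSubmodule.orthogonalProjectionOnto x = 0 := by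
  rw [Submodule.starProjection_apply, ZeroMemClass.coe_eq_zero]

/-- **`p_W` preserves `Kf`-invariance** (`H`-valued form): `π k (p_W x) = p_W x` for `k ∈ Kf`
whenever `π k x = x` for all `k ∈ Kf` (Borel–Jacquet (1979), §4.6: `K_f`-fixed vectors).
[cite: BorelJacquet1979, §4.6] -/
theorem apply_starProjection_of_forall (hπ : π.IsUnitary) (W : ClosedSubrep π) (Kf : Subgroup G)
    {x : H} (hx : ∀ k ∈ Kf, π k x = x) {k : G} (hk : k ∈ Kf) :
    π k (W.toSubmodule.starProjection x) = W.toSubmodule.starProjection x := by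
  rw [← starProjection_map_apply hπ W k x, hx k hk]

/-- `W`-valued form: if `π k x = x` for all `k ∈ Kf`, then the projection of `x` is a `Kf`-fixed
vector of `W` (`W.fixedVectors Kf` of `AutomorphicSpectrum`); `H`-level hypothesis form of the
tree's `orthogonalProjectionOnto_mem_fixedVectors`. [cite: BorelJacquet1979, §4.6] -/
theorem orthogonalProjectionOnto_mem_fixedVectors_of_forall (hπ : π.IsUnitary) (W : ClosedSubrep π)
    (Kf : Subgroup G) {x : H} (hx : ∀ k ∈ Kf, π k x = x) :
    W.toSubmodule.orthogonalProjectionOnto x ∈ W.fixedVectors Kf := by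
  rw [mem_fixedVectors]
  intro k hk
  apply Subtype.ext
  rw [coe_toContRep_apply, Submodule.coe_orthogonalProjectionOnto_apply]
  exact W.apply_starProjection_of_forall hπ Kf hx hk

/-- **`p_W` preserves `K`-type relations.** If a family of vectors `v : ι → H` transforms under
`π k` by a matrix of scalars on a finite set `s`, `π k (v j) = ∑ i ∈ s, c j i • v i`, then so does
the projected family `p_W ∘ v` (same `k`, same matrix). This is the `L²` shadow of "the component in
`Π` of a vector-valued automorphic form of `K_∞`-type `τ` has `K_∞`-type `τ`"
(Borel–Jacquet (1979), §4.6; Dixmier (1977), §5.4). [cite: BorelJacquet1979, §4.6] -/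
theorem apply_starProjection_eq_sum (hπ : π.IsUnitary) (W : ClosedSubrep π) {ι : Type*}
    (s : Finset ι) {v : ι → H} {k : G} {c : ι → ι → ℂ}
    (hv : ∀ j, π k (v j) = ∑ i ∈ s, c j i • v i) (j : ι) :
    π k (W.toSubmodule.starProjection (v j)) =
      ∑ i ∈ s, c j i • W.toSubmodule.starProjection (v i) := by
  rw [← starProjection_map_apply hπ W k (v j), hv j, map_sum]
  simp only [map_smul]

/-- `W`-valued form of `apply_starProjection_eq_sum`: the projected family transforms under
`W.toContRep k` by the same matrix. [cite: BorelJacquet1979, §4.6] -/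
theorem toContRep_orthogonalProjectionOnto_eq_sum (hπ : π.IsUnitary) (W : ClosedSubrep π)
    {ι : Type*} (s : Finset ι) {v : ι → H} {k : G} {c : ι → ι → ℂ}
    (hv : ∀ j, π k (v j) = ∑ i ∈ s, c j i • v i) (j : ι) :
    W.toContRep k (W.toSubmodule.orthogonalProjectionOnto (v j)) =
      ∑ i ∈ s, c j i • W.toSubmodule.orthogonalProjectionOnto (v i) := by
  apply Subtype.ext
  rw [coe_toContRep_apply, Submodule.coe_orthogonalProjectionOnto_apply,
    W.apply_starProjection_eq_sum hπ s hv j, Submodule.coe_sum]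
  simp only [Submodule.coe_smul, Submodule.coe_orthogonalProjectionOnto_apply]

end ClosedSubrep

namespace IsDiscretelyDecomposable

/-- **A non-zero vector of a discretely decomposable representation has a non-zero projection onto
some irreducible closed subrepresentation** (Bump (1997), proof of Thm. 3.6.1, p. 340): otherwise `x`
is orthogonal to every irreducible closed `W`, hence to the closure of their span, which is all of
`H` (`π.discretePart = ⊤`). Unitarity is not needed. Whole-space form of the tree's
`ClosedSubrep.exists_isTopIrreducible_orthogonalProjectionOnto_ne_zero` (stated for a sub-representation
`C`); deliberate dot-notation extension of `ContRepresentation.IsDiscretelyDecomposable`.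
[cite: Bump1997, Thm. 3.6.1 (proof, p. 340)] -/
theorem exists_isTopIrreducible_starProjection_ne_zero (hd : π.IsDiscretelyDecomposable)
    {x : H} (hx : x ≠ 0) :
    ∃ W : ClosedSubrep π, W.toContRep.IsTopIrreducible ∧ W.toSubmodule.starProjection x ≠ 0 := by
  by_contra hcon
  push Not at hcon
  apply hx
  set S : Set (ClosedSubrep π) := {W | W.toContRep.IsTopIrreducible} with hS
  -- `x` is orthogonal to every irreducible closed subrepresentation
  have hx' : x ∈ (⨆ W ∈ S, (W : ClosedSubrep π).toSubmodule)ᗮ := by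
    rw [← iSup_subtype'', ← Submodule.iInf_orthogonal, Submodule.mem_iInf]
    intro W
    exact (Submodule.starProjection_apply_eq_zero_iff _).mp (hcon W.1 W.2)
  -- and these span a dense subspace (`π.discretePart = ⊤`)
  have hdense : (⨆ W ∈ S, (W : ClosedSubrep π).toSubmodule).topologicalClosure = ⊤ :=
    congrArg (fun W : ClosedSubrep π => W.toSubmodule) (hd : π.discretePart = ⊤)
  rw [Submodule.topologicalClosure_eq_top_iff] at hdense
  rw [hdense, Submodule.mem_bot] at hx'
  exact hx'

/-- `W`-valued form: some irreducible closed `W` has `W.toSubmodule.orthogonalProjectionOnto x ≠ 0`.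
[cite: Bump1997, Thm. 3.6.1 (proof, p. 340)] -/
theorem exists_isTopIrreducible_orthogonalProjectionOnto_ne_zero (hd : π.IsDiscretelyDecomposable)
    {x : H} (hx : x ≠ 0) :
    ∃ W : ClosedSubrep π, W.toContRep.IsTopIrreducible ∧
      W.toSubmodule.orthogonalProjectionOnto x ≠ 0 := by
  obtain ⟨W, hW, hne⟩ := hd.exists_isTopIrreducible_starProjection_ne_zero hx
  exact ⟨W, hW, fun h =>
    hne ((ClosedSubrep.starProjection_eq_zero_iff_orthogonalProjectionOnto_eq_zero W).mpr h)⟩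

/-- **Family form** (vector-valued forms: `ι → H`, e.g. `Fin 2 → L²`): a non-zero family
`v : ι → H` has, for some irreducible closed `W`, a non-zero projected family `p_W ∘ v`.
[cite: Bump1997, Thm. 3.6.1 (proof, p. 340)] -/
theorem exists_isTopIrreducible_starProjection_comp_ne_zero (hd : π.IsDiscretelyDecomposable)
    {ι : Type*} {v : ι → H} (hv : v ≠ 0) :
    ∃ W : ClosedSubrep π, W.toContRep.IsTopIrreducible ∧
      (fun i => W.toSubmodule.starProjection (v i)) ≠ 0 := by
  obtain ⟨i, hi⟩ := Function.ne_iff.mp hv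
  obtain ⟨W, hW, hne⟩ := hd.exists_isTopIrreducible_starProjection_ne_zero hi
  exact ⟨W, hW, fun h => hne (congrFun h i)⟩

/-- **Occurrence form.** Let `π` be unitary and discretely decomposable, let a group `G'` act on
`H` through `j : G' →* G`, and let `L : Y →ₗ[ℂ] (ι → H)` be a NON-ZERO linear map intertwining a
representation `ρ` of `G'` on `Y` with `π ∘ j` in every coordinate. Then for some irreducible closed
`W` the composite `L' = p_W ∘ L` (coordinatewise) is again non-zero, takes values in `W`, and
intertwines `ρ` with `π ∘ j` coordinatewise. (At `H = L²(G(K)\G(𝔸))`, `G' = G(𝔸_f)`: an irreducible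
`σ` occurring in a space of square-integrable automorphic forms occurs, at the `L²` level, in one
discrete automorphic `Π`; Borel–Jacquet (1979), §4.6; Bump (1997), p. 342.)
[cite: BorelJacquet1979, §4.6] -/
theorem exists_isTopIrreducible_intertwiner (hπ : π.IsUnitary) (hd : π.IsDiscretelyDecomposable)
    {G' Y ι : Type*} [Group G'] [AddCommGroup Y] [Module ℂ Y] (j : G' →* G)
    (ρ : Representation ℂ G' Y) (L : Y →ₗ[ℂ] (ι → H))
    (hL : ∀ (g : G') (y : Y) (i : ι), L (ρ g y) i = π (j g) (L y i)) (hL0 : L ≠ 0) :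
    ∃ W : ClosedSubrep π, W.toContRep.IsTopIrreducible ∧
      ∃ L' : Y →ₗ[ℂ] (ι → H), L' ≠ 0 ∧
        (∀ y i, L' y i = W.toSubmodule.starProjection (L y i)) ∧ (∀ y i, L' y i ∈ W) ∧
        ∀ (g : G') (y : Y) (i : ι), L' (ρ g y) i = π (j g) (L' y i) := by
  obtain ⟨y₀, hy₀⟩ : ∃ y, L y ≠ 0 := by
    by_contra h
    push Not at h
    exact hL0 (LinearMap.ext h)
  obtain ⟨W, hW, hne⟩ := hd.exists_isTopIrreducible_starProjection_comp_ne_zero hy₀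
  refine ⟨W, hW, (W.toSubmodule.starProjection : H →ₗ[ℂ] H).compLeft ι ∘ₗ L, ?_,
    fun y i => rfl, fun y i => W.toSubmodule.starProjection_apply_mem (L y i), fun g y i => ?_⟩
  · intro h
    apply hne
    funext i
    have := congrArg (fun T : Y →ₗ[ℂ] (ι → H) => T y₀ i) h
    simpa using this
  · change W.toSubmodule.starProjection (L (ρ g y) i) =
      π (j g) (W.toSubmodule.starProjection (L y i))
    rw [hL, W.starProjection_map_apply hπ]

end IsDiscretelyDecomposable

end Hilbert

end ContRepresentation

/-! ### Automorphic part: `L²` of an automorphic quotient -/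

namespace Literature.NumberTheory.Automorphic

universe u

namespace AdelicGroupData

variable {K : Type} [Field K] [NumberField K] (𝒢 : AdelicGroupData.{u} K)
  (μ : Measure 𝒢.automorphicQuotient) [SMulInvariantMeasure 𝒢.Adelic 𝒢.automorphicQuotient μ]

/-- **Representatives are transported by the regular representation.** If the class `f ∈ L²(μ)`
is represented a.e. by the function `φ`, then `R g f` is represented a.e. by `x ↦ φ (g⁻¹ • x)`
(`rightRegular_apply_coeFn` plus invariance of `μ`: `x ↦ g⁻¹ • x` is measure preserving, so it
pulls a.e. equalities back). This is the junction between function-valued realisations of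
automorphic forms and their `L²` classes (Borel–Jacquet (1979), §4.6: `(R(g)φ)(y) = φ(yg)`).
[cite: BorelJacquet1979, §4.6] -/
theorem rightRegular_apply_coeFn_of_ae_eq (g : 𝒢.Adelic) (f : 𝒢.L2 μ)
    {φ : 𝒢.automorphicQuotient → ℂ} (hf : (f : 𝒢.automorphicQuotient → ℂ) =ᵐ[μ] φ) :
    (𝒢.rightRegular μ g f : 𝒢.automorphicQuotient → ℂ) =ᵐ[μ] fun x => φ (g⁻¹ • x) := by
  have h2 : (fun x => (f : 𝒢.automorphicQuotient → ℂ) (g⁻¹ • x)) =ᵐ[μ] fun x => φ (g⁻¹ • x) :=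
    (measurePreserving_smul g⁻¹ μ).quasiMeasurePreserving.ae_eq_comp hf
  exact (𝒢.rightRegular_apply_coeFn μ g f).trans h2

/-- In particular, if `f` is represented a.e. by `φ` and `f'` a.e. by `x ↦ φ (g⁻¹ • x)`, then
`R g f = f'` (a.e. equality of representatives determines the class, Mathlib `Lp.ext`).
[cite: BorelJacquet1979, §4.6] -/
theorem rightRegular_apply_eq_of_ae_eq (g : 𝒢.Adelic) (f f' : 𝒢.L2 μ)
    {φ : 𝒢.automorphicQuotient → ℂ} (hf : (f : 𝒢.automorphicQuotient → ℂ) =ᵐ[μ] φ)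
    (hf' : (f' : 𝒢.automorphicQuotient → ℂ) =ᵐ[μ] fun x => φ (g⁻¹ • x)) :
    𝒢.rightRegular μ g f = f' :=
  Lp.ext ((𝒢.rightRegular_apply_coeFn_of_ae_eq μ g f hf).trans hf'.symm)

end AdelicGroupData

section Discrete

variable {K : Type} [Field K] [NumberField K] {𝒢 : AdelicGroupData.{u} K}
  {μ : Measure 𝒢.automorphicQuotient} [SMulInvariantMeasure 𝒢.Adelic 𝒢.automorphicQuotient μ]

namespace DiscreteAutomorphicRep

/-- **The component map `p_Π : L² → L²` of a discrete automorphic representation is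
`G(𝔸_K)`-equivariant**: `p_Π (R g f) = R g (p_Π f)` (`R` is unitary, `isUnitary_rightRegular`;
Bump (1997), proof of Thm. 3.6.1, p. 342; Borel–Jacquet (1979), §4.6).
[cite: Bump1997, Thm. 3.6.1 (proof, p. 342)] -/
theorem starProjection_rightRegular (P : DiscreteAutomorphicRep 𝒢 μ) (g : 𝒢.Adelic) (f : 𝒢.L2 μ) :
    P.space.toSubmodule.starProjection (𝒢.rightRegular μ g f) =
      𝒢.rightRegular μ g (P.space.toSubmodule.starProjection f) :=
  P.space.starProjection_map_apply (𝒢.isUnitary_rightRegular μ) g f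

/-- `Π`-valued form: `p_Π (R g f) = Π(g) (p_Π f)` with `Π(g) = P.space.toContRep g`.
[cite: Bump1997, Thm. 3.6.1 (proof, p. 342)] -/
theorem orthogonalProjectionOnto_rightRegular (P : DiscreteAutomorphicRep 𝒢 μ) (g : 𝒢.Adelic)
    (f : 𝒢.L2 μ) :
    P.space.toSubmodule.orthogonalProjectionOnto (𝒢.rightRegular μ g f) =
      P.space.toContRep g (P.space.toSubmodule.orthogonalProjectionOnto f) := by
  apply Subtype.ext
  rw [ContRepresentation.ClosedSubrep.coe_toContRep_apply, Submodule.coe_orthogonalProjectionOnto_apply,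
    Submodule.coe_orthogonalProjectionOnto_apply]
  exact P.starProjection_rightRegular g f

/-- **`p_Π` preserves the level**: a `Kf`-invariant `f ∈ L²` projects to a `Kf`-fixed vector of
`Π` (`P.space.fixedVectors Kf` of `AutomorphicSpectrum`; Borel–Jacquet (1979), §4.6).
[cite: BorelJacquet1979, §4.6] -/
theorem orthogonalProjectionOnto_mem_fixedVectors (P : DiscreteAutomorphicRep 𝒢 μ)
    (Kf : Subgroup 𝒢.Adelic) {f : 𝒢.L2 μ} (hf : ∀ k ∈ Kf, 𝒢.rightRegular μ k f = f) :
    P.space.toSubmodule.orthogonalProjectionOnto f ∈ P.space.fixedVectors Kf :=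
  P.space.orthogonalProjectionOnto_mem_fixedVectors_of_forall (𝒢.isUnitary_rightRegular μ) Kf hf

/-- `L²`-valued form: `R k (p_Π f) = p_Π f` for `k ∈ Kf` if `R k f = f` for all `k ∈ Kf`.
[cite: BorelJacquet1979, §4.6] -/
theorem rightRegular_starProjection_of_forall (P : DiscreteAutomorphicRep 𝒢 μ)
    (Kf : Subgroup 𝒢.Adelic) {f : 𝒢.L2 μ} (hf : ∀ k ∈ Kf, 𝒢.rightRegular μ k f = f)
    {k : 𝒢.Adelic} (hk : k ∈ Kf) :
    𝒢.rightRegular μ k (P.space.toSubmodule.starProjection f) =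
      P.space.toSubmodule.starProjection f :=
  P.space.apply_starProjection_of_forall (𝒢.isUnitary_rightRegular μ) Kf hf hk

/-- **`p_Π` preserves `K`-type relations** among a family of classes `v : ι → L²` (the coordinates
of a vector-valued automorphic form): `R k (v j) = ∑ i ∈ s, c j i • v i` for all `j` implies the
same for `p_Π ∘ v` (Borel–Jacquet (1979), §4.6). [cite: BorelJacquet1979, §4.6] -/
theorem rightRegular_starProjection_eq_sum (P : DiscreteAutomorphicRep 𝒢 μ) {ι : Type*}
    (s : Finset ι) {v : ι → 𝒢.L2 μ} {k : 𝒢.Adelic} {c : ι → ι → ℂ}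
    (hv : ∀ j, 𝒢.rightRegular μ k (v j) = ∑ i ∈ s, c j i • v i) (j : ι) :
    𝒢.rightRegular μ k (P.space.toSubmodule.starProjection (v j)) =
      ∑ i ∈ s, c j i • P.space.toSubmodule.starProjection (v i) :=
  P.space.apply_starProjection_eq_sum (𝒢.isUnitary_rightRegular μ) s hv j

end DiscreteAutomorphicRep

/-- **Every non-zero `f ∈ L²` has a non-zero component in some discrete automorphic
representation**, provided `L²` decomposes discretely (`(𝒢.rightRegular μ).IsDiscretelyDecomposable`,
i.e. `L² = L²_disc`: for a compact quotient `G(K) A_G \ G(𝔸_K)` this is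
Gelfand–Graev–Piatetski-Shapiro, tree
`AdelicGroupData.isDiscretelyDecomposable_rightRegular_of_locallyCompactSpace`; for an anisotropic
unitary group `UnitaryGroup.isDiscretelyDecomposable_rightRegular_adelicGroupData`)
(Borel–Jacquet (1979), §4.6; Bump (1997), proof of Thm. 3.6.1, p. 340).
[cite: BorelJacquet1979, §4.6] -/
theorem exists_discreteAutomorphicRep_starProjection_ne_zero
    (hd : (𝒢.rightRegular μ).IsDiscretelyDecomposable) {f : 𝒢.L2 μ} (hf : f ≠ 0) :
    ∃ P : DiscreteAutomorphicRep 𝒢 μ, P.space.toSubmodule.starProjection f ≠ 0 := by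
  obtain ⟨W, hW, hne⟩ := hd.exists_isTopIrreducible_starProjection_ne_zero hf
  exact ⟨⟨W, hW⟩, hne⟩

/-- `Π`-valued form of `exists_discreteAutomorphicRep_starProjection_ne_zero`.
[cite: BorelJacquet1979, §4.6] -/
theorem exists_discreteAutomorphicRep_orthogonalProjectionOnto_ne_zero
    (hd : (𝒢.rightRegular μ).IsDiscretelyDecomposable) {f : 𝒢.L2 μ} (hf : f ≠ 0) :
    ∃ P : DiscreteAutomorphicRep 𝒢 μ, P.space.toSubmodule.orthogonalProjectionOnto f ≠ 0 := by
  obtain ⟨W, hW, hne⟩ := hd.exists_isTopIrreducible_orthogonalProjectionOnto_ne_zero hf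
  exact ⟨⟨W, hW⟩, hne⟩

/-- **Family form** (coordinates `v : ι → L²` of a vector-valued form, e.g. `ι = Fin 2`): a
non-zero family has a non-zero projected family `p_Π ∘ v` for some discrete automorphic `Π`.
[cite: BorelJacquet1979, §4.6] -/
theorem exists_discreteAutomorphicRep_starProjection_comp_ne_zero
    (hd : (𝒢.rightRegular μ).IsDiscretelyDecomposable) {ι : Type*} {v : ι → 𝒢.L2 μ} (hv : v ≠ 0) :
    ∃ P : DiscreteAutomorphicRep 𝒢 μ, (fun i => P.space.toSubmodule.starProjection (v i)) ≠ 0 := by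
  obtain ⟨W, hW, hne⟩ := hd.exists_isTopIrreducible_starProjection_comp_ne_zero hv
  exact ⟨⟨W, hW⟩, hne⟩

/-- **Occurrence form at the `L²` level.** Let `G'` act on `L²` through `j : G' →* G(𝔸_K)` (e.g.
`G' = G(𝔸_{K,f})`), and let `L : Y →ₗ[ℂ] (ι → L²)` be a non-zero linear map intertwining a
representation `ρ` of `G'` with `R ∘ j` in each coordinate (the `L²` classes of the coordinates of
the forms in the image of an equivariant map `Y →` automorphic forms). If `L²` decomposes discretely,
then for some discrete automorphic `Π` the composite `p_Π ∘ L` is non-zero, `Π`-valued and again a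
coordinatewise intertwiner (Borel–Jacquet (1979), §4.6; Bump (1997), p. 342).
[cite: BorelJacquet1979, §4.6] -/
theorem exists_discreteAutomorphicRep_intertwiner
    (hd : (𝒢.rightRegular μ).IsDiscretelyDecomposable)
    {G' Y ι : Type*} [Group G'] [AddCommGroup Y] [Module ℂ Y] (j : G' →* 𝒢.Adelic)
    (ρ : Representation ℂ G' Y) (L : Y →ₗ[ℂ] (ι → 𝒢.L2 μ))
    (hL : ∀ (g : G') (y : Y) (i : ι), L (ρ g y) i = 𝒢.rightRegular μ (j g) (L y i)) (hL0 : L ≠ 0) :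
    ∃ P : DiscreteAutomorphicRep 𝒢 μ, ∃ L' : Y →ₗ[ℂ] (ι → 𝒢.L2 μ), L' ≠ 0 ∧
      (∀ y i, L' y i = P.space.toSubmodule.starProjection (L y i)) ∧ (∀ y i, L' y i ∈ P.space) ∧
      ∀ (g : G') (y : Y) (i : ι), L' (ρ g y) i = 𝒢.rightRegular μ (j g) (L' y i) := by
  obtain ⟨W, hW, L', h0, h1, h2, h3⟩ :=
    hd.exists_isTopIrreducible_intertwiner (𝒢.isUnitary_rightRegular μ) j ρ L hL hL0
  exact ⟨⟨W, hW⟩, L', h0, h1, h2, h3⟩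

end Discrete

end Literature.NumberTheory.Automorphic

end
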